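import Summits.BirchSwinnertonDyer.BirchSwinnertonDyer.Theses.PrintCf2
import HarnessLib

/-!
# Route PrintCf2 — aside item `InertKrizLiTwoFortyThreeOfFactsPlus` CLOSED

Cell `bsd-print-cf2` (D-0131 (2) PRINT TIER, leaf CornerF @ `p = 2`), prover p3. The aside is the BY-NAME
slice of the inert type on the `ℚ`-isogeny classes of the Kriz–Li 2019 twists of `243a1` (`= x³ + y³ = 9`):
granted 𝔅_inert (the eight facts of `InertTwoRankOneOfFacts`, VERBATIM) ∧ Kriz–Li 2019 Thm 4.3
(`KrizLi2019.thm33_rank_twist`) ∧ Creutz–Miller 2012 Thm 1.1 (`bsdTriple_of_analyticRank_le_one_of_conductor_lt`)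
∧ the Kriz–Li Table-1 row `243a1` (`KrizLi2019.table1_row243a1`), the W-ALL leaf
`Summit.BirchSwinnertonDyer.WAllCornerFTwoInertKrizLiTwoFortyThree` holds. Proof: destructure the bundle and
apply p3's leaf closer `wAllCornerFTwoInertKrizLiTwoFortyThree_of_facts` (p547569), which needs exactly
Kriz–Li Thm 5.1 (2) (conjunct 5), Thm 4.3, the Table row, Creutz–Miller, Burungale–Flach (4), modularity
(2), GZK (1) and Cassels (3). beyond-print: YES as an assembly of printed theorems (the rank-zero base
`BSD(243a1^{(−23)}, 2)` is Burungale–Flach 2024 where Kriz–Li say "numerical verification"), NO as a method.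
[cite: KrizLi2019, Thm. 5.1 (2), Thm. 4.3, §6 Table 1 row 243a1 and Rem. 6.3]
-/

-- single-conjunct summit: `Summit.BirchSwinnertonDyer.BirchSwinnertonDyer.…` repeats the name by design
set_option linter.dupNamespace false

namespace Summit.BirchSwinnertonDyer.BirchSwinnertonDyer.Theorems

/-- **Item `InertKrizLiTwoFortyThreeOfFactsPlus` holds**: 𝔅_inert ∧ Thm 4.3 ∧ Creutz–Miller ∧ Table-1
row ⟹ the Kriz–Li `243a1` leaf of the inert type, by `wAllCornerFTwoInertKrizLiTwoFortyThree_of_facts`.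
[cite: KrizLi2019, Thm. 5.1 (2), Thm. 4.3 and §6 Table 1 row 243a1] [cite: CreutzMiller2012, Thm. 1.1]
[cite: BurungaleFlach2024, Thm. 1.1 and Cor. 2] [cite: MilneADT2006, Thm. I.7.3] -/
theorem inertKrizLiTwoFortyThreeOfFactsPlus_proof :
    Summit.BirchSwinnertonDyer.BirchSwinnertonDyer.Theses.PrintCf2.InertKrizLiTwoFortyThreeOfFactsPlus := by
  unfold Summit.BirchSwinnertonDyer.BirchSwinnertonDyer.Theses.PrintCf2.InertKrizLiTwoFortyThreeOfFactsPlus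
  rintro ⟨⟨hGZK, hmod, hCas, hBF, hKL, _, _, _⟩, h33, hS31, htab⟩
  exact Summit.BirchSwinnertonDyer.wAllCornerFTwoInertKrizLiTwoFortyThree_of_facts hKL h33 htab hS31 hBF hmod
    hGZK hCas

end Summit.BirchSwinnertonDyer.BirchSwinnertonDyer.Theorems
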